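import Literature.Computability.Cryptography.BLPRSSection4AssemblyClose
import Literature.Computability.Cryptography.LWECandidateSelectClose
import HarnessLib

/-!
# BLPRS §4 assembled with EXPLICIT candidates, an approximate raising noise and an approximate self-measurement

Topic `Computability/Cryptography` (LWE), grouping namespace `BLPRS2013`; sequel of `BLPRSSection4AssemblyClose.lean` (`section4_selected_of_close`: the
law-level reduction of hypothesis `h₃` of `BLPRSReduction.lean`, with Lemma 4.7 as an EXISTENTIAL hypothesis and the IDEAL selection stage) and of
`LWECandidateSelectClose.lean` (`selectWith`: selection from an approximate measurement law). A MACHINE realises the three candidate distinguishers of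
BLPRS's Thm. 4.1 as programs, so the law-level statement it needs has them EXPLICIT: Lemma 4.7 enters as a TRANSFORMATION `R47` (every `z`-choosing
`extLWE` adversary `D` is answered by the first-is-errorless distinguisher `R47 ζ' D`, up to `L₄₇`), the candidates are the printed compositions
(`felReduction ∘ R47 ∘ extLWEMultiReduction(Z) ∘ hybridB₁/₃`, `dimExtendThen 0 ∘ shiftThen ∘ hybridB₂`), the raising noise `Ψ̄_Q(u)` is replaced by
any `ν_u`-close law (the machine's sampler, `LWEPsiBarSampler.lean`), and the measurement by any `δ`-close law. Everything PROVED; three definitions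
with bodies (`R47Type`, `candE₁`, `candE₂`, `candE₃`, `candVec`); no named fact:

* `R47Type`, `candE₁`, `candE₂`, `candE₃` (the explicit candidates for a test `A'`), **`blprs_theorem_4_1_bound_explicit`** (Thm. 4.1's bookkeeping
  with `R47`; the tree's `blprs_theorem_4_1_bound` made explicit);
* `abs_acceptProb_raiseThen_sub_le`, `distinguishingAdvantage_raiseThen_close` (raising with a `ν`-close noise costs `≤ 2mν`);
* `candVec` (the padded/raised candidate vector), **`section4_selected_explicit`** — the final law-level statement the machine instantiates: for the
  explicit candidate vector and ANY measurement law `Est` with `Δ(Est, candEstLaw) ≤ δ`, `Adv_{Ψ̄_Q(α₂)}[selectWith candVec N_sel Est] ≥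
  η⋆/2 − 2·3·32/(N_sel η⋆²) − 2δ` (the threshold inequality carries the extra raising cost `2·max(M, m_fel)·ν_u`).

## References

* Z. Brakerski, A. Langlois, C. Peikert, O. Regev, D. Stehlé, *Classical hardness of learning with errors*, STOC 2013; arXiv:1306.0281, Thm. 4.1
  (proof, p. 17), Lemmas 4.3, 4.7, 4.8, 4.9, Cor. 3.2, Lemma 2.15, p. 13 and §5. [BrakerskiEtAl2013]
* O. Regev, *On lattices, learning with errors …*, J. ACM 56 (2009), Lemma 4.1. [RegevLWE2009]
* O. Goldreich, *Foundations of Cryptography I*, CUP 2001, §3.2.1–§3.2.3. [Goldreich2001]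
-/

noncomputable section

open MeasureTheory Literature.Algebra.EuclideanLattices Literature.Probability.Distributions Literature.Algebra.Module
open scoped Real ENNReal

namespace Literature.Computability.Cryptography

namespace BLPRS2013

open LWE LWE.MP12

/-! ### The explicit candidates and Theorem 4.1's bookkeeping -/

section Explicit

variable {n k q : ℕ} [NeZero q]

/-- The type of a transformation answering Lemma 4.7: a law of `z` and a `z`-choosing `extLWE_{k+1}` adversary in, a first-is-errorless
distinguisher out. [cite: BrakerskiEtAl2013, Lemma 4.7] -/
abbrev R47Type (n k q mfel : ℕ) : Type :=
  PMF (Fin n → ℤ) → ((Fin n → ℤ) × (Matrix (Fin (k + 1)) (Fin n) (ZMod q) × (Fin 1 → (Fin n → ZMod q) × ℤ)) → PMF Bool) →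
    (((Fin (k + 1) → ZMod q) × ZMod q) × (Fin mfel → (Fin (k + 1) → ZMod q) × ZMod q) → PMF Bool)

variable (χh : PMF (ZMod q)) (χN : PMF (Fin n → ℤ)) (ζ : PMF (Fin n → ℤ)) (m mfel : ℕ) [NeZero m] (R47 : R47Type n k q mfel)

/-- **Candidate 1**: `felReduction ∘ R47 ζ ∘ extLWEMultiReductionZ ∘ hybridB₁`. [cite: BrakerskiEtAl2013, Thm. 4.1 (proof), Lemmas 4.3, 4.7, 4.8, 4.9] -/
def candE₁ (A : Distinguisher (Fin n) (ZMod q) m) : Distinguisher (Fin k) (ZMod q) mfel :=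
  felReduction (fun v : Fin (k + 1) → ZMod q => IsUnimodularVector v) unimodularCompletion mfel
    (R47 ζ (extLWEMultiReductionZ χN m (hybridB₁ (k := k + 1) χh m A)))

/-- **Candidate 3**: `felReduction ∘ R47 δ₀ ∘ extLWEMultiReduction(z = 0) ∘ hybridB₃`. [cite: BrakerskiEtAl2013, Thm. 4.1 (proof), Lemmas 4.3, 4.7, 4.8, 4.9] -/
def candE₃ (A : Distinguisher (Fin n) (ZMod q) m) : Distinguisher (Fin k) (ZMod q) mfel :=
  felReduction (fun v : Fin (k + 1) → ZMod q => IsUnimodularVector v) unimodularCompletion mfel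
    (R47 (PMF.pure 0) (fun p => (extLWEMultiReduction χN m (0 : Fin n → ℤ) (hybridB₃ (k := k + 1) m A)) p.2))

/-- **Candidate 2**: `dimExtendThen 0 ∘ shiftThen ∘ hybridB₂`. [cite: BrakerskiEtAl2013, Thm. 4.1 (proof), Lemma 4.9] -/
def candE₂ (A : Distinguisher (Fin n) (ZMod q) m) : Distinguisher (Fin k) (ZMod q) m :=
  dimExtendThen 0 (shiftThen m (hybridB₂ (k := k + 1) χN m A))

/-- **Theorem 4.1's bookkeeping with an explicit Lemma 4.7** (the tree's `blprs_theorem_4_1_bound`, with its two uses of the existential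
hypothesis replaced by the transformation `R47`). [cite: BrakerskiEtAl2013, Thm. 4.1 (proof)] -/
theorem blprs_theorem_4_1_bound_explicit (χ₀ : (Fin n → ZMod q) → PMF (ZMod q)) (χsrc : PMF (ZMod q))
    (hζ : ∀ z ∈ ζ.support, ∀ i, z i = 0 ∨ z i = 1) {η L47 : ℝ}
    (hη : ∀ z : Fin n → ℤ, (χ₀ (intCastVec z)).tvDist (noiseH₁ χN χh (intCastVec z)) ≤ η)
    (h47 : ∀ ζ' : PMF (Fin n → ℤ), (∀ z ∈ ζ'.support, ∀ i, z i = 0 ∨ z i = 1) →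
      ∀ D : (Fin n → ℤ) × (Matrix (Fin (k + 1)) (Fin n) (ZMod q) × (Fin 1 → (Fin n → ZMod q) × ℤ)) → PMF Bool,
        extLWEAdvantageZ ζ' χN 1 D ≤ felAdvantage χsrc mfel (R47 ζ' D) + L47)
    (A : Distinguisher (Fin n) (ZMod q) m) :
    |(acceptProb A (hybridH₀ χ₀ m ζ)).toReal - (acceptProb A (uniformSamples (Fin n) (ZMod q) m)).toReal| ≤
      m * η + (lawCz (k + 1) ζ).tvDist (PMF.uniformOfFintype (Matrix (Fin (k + 1)) (Fin n) (ZMod q) × (Fin (k + 1) → ZMod q))) +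
        m * (distinguishingAdvantage χsrc mfel (candE₁ χh χN ζ m mfel R47 A) + ∑ p ∈ q.primeFactors, ((p : ℝ) ^ (k + 1))⁻¹ + L47) +
        distinguishingAdvantage χh m (candE₂ (k := k) χN m A) +
        m * (distinguishingAdvantage χsrc mfel (candE₃ χN m mfel R47 A) + ∑ p ∈ q.primeFactors, ((p : ℝ) ^ (k + 1))⁻¹ + L47) := by
  classical
  have hm0 : (0 : ℝ) ≤ m := Nat.cast_nonneg m
  -- Lemma 4.9 (full chain) at `extLWE` dimension `k + 1`
  have h49 := advantage_hybridH₀_le (k := k + 1) χ₀ χN χh m ζ hη A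
  -- branch 1
  set B₁ := hybridB₁ (k := k + 1) χh m A with hB₁
  have h48₁ := extLWEAdvantageZ_multiReduction ζ χN m B₁
  have hD₁ := h47 ζ hζ (extLWEMultiReductionZ χN m B₁)
  have h43₁ := felAdvantage_le_sum_primeFactors χsrc mfel (R47 ζ (extLWEMultiReductionZ χN m B₁))
  -- branch 2
  set B₂ := hybridB₂ (k := k + 1) χN m A with hB₂
  have hdim := distinguishingAdvantage_dimExtendThen_shiftThen χh (0 : ZMod q) m B₂
  -- branch 3
  set B₃ := hybridB₃ (k := k + 1) m A with hB₃
  have h48₃ := extLWEAdvantage_multiReduction χN m (0 : Fin n → ℤ) B₃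
  set B₃' := extLWEMultiReduction χN m (0 : Fin n → ℤ) B₃ with hB₃'
  have hpure := extLWEAdvantageZ_pure (R := ZMod q) χN 1 (0 : Fin n → ℤ)
    (fun p : (Fin n → ℤ) × (Matrix (Fin (k + 1)) (Fin n) (ZMod q) × (Fin 1 → (Fin n → ZMod q) × ℤ)) => B₃' p.2)
  have hζ0 : ∀ z ∈ (PMF.pure (0 : Fin n → ℤ)).support, ∀ i, z i = 0 ∨ z i = 1 := by
    intro z hz i
    rw [PMF.support_pure, Set.mem_singleton_iff] at hz
    exact Or.inl (by rw [hz]; rfl)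
  have hD₃ := h47 (PMF.pure 0) hζ0 (fun p => B₃' p.2)
  rw [hpure] at hD₃
  have h43₃ := felAdvantage_le_sum_primeFactors χsrc mfel (R47 (PMF.pure 0) (fun p => B₃' p.2))
  -- bookkeeping
  have hT1 : extLWEAdvantageZ ζ χN m B₁ ≤
      m * (distinguishingAdvantage χsrc mfel (candE₁ χh χN ζ m mfel R47 A) + ∑ p ∈ q.primeFactors, ((p : ℝ) ^ (k + 1))⁻¹ + L47) := by
    rw [← h48₁]
    refine mul_le_mul_of_nonneg_left ?_ hm0
    unfold candE₁
    linarith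
  have hT4 : extLWEAdvantage χN m 0 B₃ ≤
      m * (distinguishingAdvantage χsrc mfel (candE₃ χN m mfel R47 A) + ∑ p ∈ q.primeFactors, ((p : ℝ) ^ (k + 1))⁻¹ + L47) := by
    rw [← h48₃]
    refine mul_le_mul_of_nonneg_left ?_ hm0
    unfold candE₃
    linarith
  have h2 : distinguishingAdvantage χh m (candE₂ (k := k) χN m A) = distinguishingAdvantage χh m B₂ := by
    unfold candE₂; exact hdim
  rw [h2]
  linarith

end Explicit

/-! ### Raising with a close noise -/

section Raise

variable {ι : Type} [Fintype ι] [DecidableEq ι] {R : Type} [CommRing R] [Fintype R] {m : ℕ}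

omit [Fintype ι] [DecidableEq ι] [Fintype R] in
/-- Raising with `χ₁` or with `χ₂` changes an acceptance probability by `≤ m·Δ(χ₁, χ₂)`. [cite: Goldreich2001, §3.2.1, §3.2.3] -/
theorem abs_acceptProb_raiseThen_sub_le (χ₁ χ₂ : PMF R) (D : Distinguisher ι R m) (P : PMF (Fin m → (ι → R) × R)) :
    |(acceptProb (raiseThen χ₁ m D) P).toReal - (acceptProb (raiseThen χ₂ m D) P).toReal| ≤ m * χ₁.tvDist χ₂ := by
  rw [acceptProb_raiseThen, acceptProb_raiseThen]
  refine (abs_acceptProb_toReal_sub_le_tvDist D _ _).trans ?_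
  refine (PMF.tvDist_bind_le_of_forall_le P _ _ fun S => ?_)
  refine (PMF.tvDist_map_le_holds _ _ _).trans ?_
  exact tvDist_iidPMF_le χ₁ χ₂ m

/-- **Raising with a `ν`-close noise costs at most `2mν` of advantage.** [cite: BrakerskiEtAl2013, §5; Goldreich2001, §3.2.1] -/
theorem distinguishingAdvantage_raiseThen_close (χ : PMF R) {χ₁ χ₂ : PMF R} {ν : ℝ} (hν : χ₁.tvDist χ₂ ≤ ν) (D : Distinguisher ι R m) :
    distinguishingAdvantage χ m (raiseThen χ₂ m D) - 2 * (m * ν) ≤ distinguishingAdvantage χ m (raiseThen χ₁ m D) := by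
  unfold distinguishingAdvantage
  have h1 := abs_acceptProb_raiseThen_sub_le χ₁ χ₂ D (lweSamplesUniformSecret χ m)
  have h2 := abs_acceptProb_raiseThen_sub_le χ₁ χ₂ D (uniformSamples ι R m)
  have hm : (m : ℝ) * χ₁.tvDist χ₂ ≤ m * ν := mul_le_mul_of_nonneg_left hν (Nat.cast_nonneg m)
  rw [abs_le] at h1 h2
  have := abs_sub_abs_le_abs_sub
    ((acceptProb (raiseThen χ₂ m D) (lweSamplesUniformSecret χ m)).toReal - (acceptProb (raiseThen χ₂ m D) (uniformSamples ι R m)).toReal)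
    ((acceptProb (raiseThen χ₁ m D) (lweSamplesUniformSecret χ m)).toReal - (acceptProb (raiseThen χ₁ m D) (uniformSamples ι R m)).toReal)
  have habs : |((acceptProb (raiseThen χ₂ m D) (lweSamplesUniformSecret χ m)).toReal - (acceptProb (raiseThen χ₂ m D) (uniformSamples ι R m)).toReal) -
      ((acceptProb (raiseThen χ₁ m D) (lweSamplesUniformSecret χ m)).toReal - (acceptProb (raiseThen χ₁ m D) (uniformSamples ι R m)).toReal)| ≤
      2 * (m * ν) := by
    rw [abs_le]; constructor <;> linarith [h1.1, h1.2, h2.1, h2.2]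
  linarith

end Raise

/-! ### The selection with explicit candidates, approximate raising noise and approximate measurement -/

section Selected

variable {n Q q' d : ℕ} [NeZero Q] [NeZero q'] {r B : ℝ} {G : ℕ} {τ : Fin G → ℝ} {m₃ N N' mfel : ℕ} {θ : ℝ}

/-- **The explicit candidate vector** on `max (G·(N·m₃)) mfel` samples: `(pad E₁, raise χ_u⁺ (pad E₂), pad E₃)`. [cite: BrakerskiEtAl2013, Thm. 4.1 (proof), p. 13] -/
def candVec (χh : PMF (ZMod Q)) (χN : PMF (Fin n → ℤ)) (ζ : PMF (Fin n → ℤ)) (χut : PMF (ZMod Q)) [NeZero (G * (N * m₃))]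
    (R47 : R47Type n d Q mfel) (A' : Distinguisher (Fin n) (ZMod Q) (G * (N * m₃))) :
    Fin (2 + 1) → Distinguisher (Fin d) (ZMod Q) (max (G * (N * m₃)) mfel) :=
  ![padThen (le_max_right _ _) (candE₁ χh χN ζ (G * (N * m₃)) mfel R47 A'),
    raiseThen χut (max (G * (N * m₃)) mfel) (padThen (le_max_left _ _) (candE₂ (k := d) χN (G * (N * m₃)) A')),
    padThen (le_max_right _ _) (candE₃ χN (G * (N * m₃)) mfel R47 A')]

/-- **BLPRS §4 for the machine, at the level of laws**: explicit candidates (Lemma 4.7 as the transformation `R47`), a `ν_u`-close raising noise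
`χut ≈ Ψ̄_Q(u)`, and a `δ`-close measurement law `Est`; conclusion for `selectWith candVec N_sel Est`.
[cite: BrakerskiEtAl2013, Thm. 4.1 (proof), Cor. 3.2, Lemma 2.15, p. 13 and §5; RegevLWE2009, Lemma 4.1] -/
theorem section4_selected_explicit {ε α₀ α₂ u η₀ L47 ν νu δ : ℝ} (Nsel : ℕ) (hn : 0 < n) (hε : 0 < ε) (hε' : ε ≤ 1 / 2)
    (hr : max (Q : ℝ)⁻¹ (q' : ℝ)⁻¹ * Real.sqrt (2 * Real.log (2 * n * (1 + 1 / ε)) / π) ≤ r) (hα₀ : 0 < α₀) (hα₂ : 0 < α₂)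
    (hG : 0 < G) (hN : 0 < N) (hN' : 0 < N') (hm₃ : 0 < m₃) (hθ : 0 < θ) (hNsel : 0 < Nsel)
    (K : (Fin m₃ → (Fin n → ZMod q') × ZMod q') → PMF Bool)
    (A' : Distinguisher (Fin n) (ZMod Q) (G * (N * m₃)))
    (hA' : ∀ P : PMF (Fin (G * (N * m₃)) → (Fin n → ZMod Q) × ZMod Q),
      |(acceptProb A' P).toReal -
        (acceptProb (flatGuessTest K N m₃ (rateGuessKernel n Q q' r B τ m₃) (uniformSamples (Fin n) (ZMod q') m₃) N' θ) P).toReal| ≤ ν)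
    (χN : PMF (Fin n → ℤ)) (ρ₀ : (Fin n → ZMod Q) → ℝ) (ζ : PMF (Fin n → ℤ))
    (hζ : ∀ z ∈ ζ.support, ∀ i, z i = 0 ∨ z i = 1)
    (hnoise : ∀ z ∈ ζ.support, (noiseH₁ χN (discretizedGaussian Q (Real.sqrt (α₂ ^ 2 + u ^ 2))) (intCastVec z : Fin n → ZMod Q)).tvDist
      (discretizedGaussian Q (ρ₀ (intCastVec z))) ≤ η₀)
    (hζ' : ∀ z ∈ ζ.support, ‖intVecToEuclidean n z‖ ≤ B ∧ α₀ ≤ ρ₀ (intCastVec z) ∧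
      ∃ w : Fin G, 4 * θ ≤ distinguishingAdvantage (discretizedGaussian q'
        (Real.sqrt (Real.sqrt (ρ₀ (intCastVec z) ^ 2 + r ^ 2 * (‖intVecToEuclidean n z‖ ^ 2 + B ^ 2)) ^ 2 + τ w ^ 2))) m₃ K)
    (hεθ : m₃ * (4 * ε) ≤ θ / 2) (hQθ : m₃ * (2 / (α₀ * Q) + 10 * ε) + m₃ * η₀ ≤ 2 * θ)
    (R47 : R47Type n d Q mfel)
    (h47 : ∀ ζ' : PMF (Fin n → ℤ), (∀ z ∈ ζ'.support, ∀ i, z i = 0 ∨ z i = 1) →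
      ∀ D : (Fin n → ℤ) × (Matrix (Fin (d + 1)) (Fin n) (ZMod Q) × (Fin 1 → (Fin n → ZMod Q) × ℤ)) → PMF Bool,
        extLWEAdvantageZ ζ' χN 1 D ≤ felAdvantage (discretizedGaussian Q α₂) mfel (R47 ζ' D) + L47)
    (χut : PMF (ZMod Q)) (hχut : χut.tvDist (discretizedGaussian Q u) ≤ νu)
    {ηstar : ℝ} (hηstar : 0 < ηstar)
    (hη : ηstar ≤ (1 - ((G + 1) * (4 / (N * θ ^ 2)) + 8 / (N' * θ ^ 2)) - 2 * ν -
          (lawCz (d + 1) ζ).tvDist (PMF.uniformOfFintype (Matrix (Fin (d + 1)) (Fin n) (ZMod Q) × (Fin (d + 1) → ZMod Q))) -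
          2 * (G * (N * m₃) : ℕ) * (∑ p ∈ Q.primeFactors, ((p : ℝ) ^ (d + 1))⁻¹ + L47)) / (2 * (G * (N * m₃) : ℕ) + 1) -
        (G * (N * m₃) : ℕ) * (1 / (2 * Q * α₂)) - 2 * ((max (G * (N * m₃)) mfel : ℕ) * νu))
    (Est : PMF (Fin (2 + 1) → (Fin Nsel → Bool) × (Fin Nsel → Bool)))
    (hEst : haveI : NeZero (G * (N * m₃)) := ⟨(Nat.mul_pos hG (Nat.mul_pos hN hm₃)).ne'⟩
      Est.tvDist (candEstLaw (discretizedGaussian Q α₂) (candVec (discretizedGaussian Q (Real.sqrt (α₂ ^ 2 + u ^ 2))) χN ζ χut R47 A') Nsel) ≤ δ) :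
    haveI : NeZero (G * (N * m₃)) := ⟨(Nat.mul_pos hG (Nat.mul_pos hN hm₃)).ne'⟩
    ηstar / 2 - 2 * ((2 + 1 : ℕ) * (32 / (Nsel * ηstar ^ 2))) - 2 * δ ≤
      distinguishingAdvantage (discretizedGaussian Q α₂) (max (G * (N * m₃)) mfel)
        (selectWith (candVec (discretizedGaussian Q (Real.sqrt (α₂ ^ 2 + u ^ 2))) χN ζ χut R47 A') Nsel Est) := by
  haveI : NeZero (G * (N * m₃)) := ⟨(Nat.mul_pos hG (Nat.mul_pos hN hm₃)).ne'⟩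
  set χh := discretizedGaussian Q (Real.sqrt (α₂ ^ 2 + u ^ 2)) with hχh
  set E₁ := candE₁ χh χN ζ (G * (N * m₃)) mfel R47 A' with hE₁
  set E₃ := candE₃ χN (G * (N * m₃)) mfel R47 A' with hE₃
  set E₂ := candE₂ (k := d) χN (G * (N * m₃)) A' with hE₂
  -- Thm. 4.1's bookkeeping (explicit) and the ideal test's advantage (`section4_three_candidates_of_close`'s argument, explicit)
  have hsum : 1 - ((G + 1) * (4 / (N * θ ^ 2)) + 8 / (N' * θ ^ 2)) - 2 * ν -
      (lawCz (d + 1) ζ).tvDist (PMF.uniformOfFintype (Matrix (Fin (d + 1)) (Fin n) (ZMod Q) × (Fin (d + 1) → ZMod Q))) ≤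
      ((G * (N * m₃) : ℕ) : ℝ) * (distinguishingAdvantage (discretizedGaussian Q α₂) mfel E₁ + (∑ p ∈ Q.primeFactors, ((p : ℝ) ^ (d + 1))⁻¹ + L47)) +
        distinguishingAdvantage χh (G * (N * m₃)) E₂ +
        ((G * (N * m₃) : ℕ) : ℝ) * (distinguishingAdvantage (discretizedGaussian Q α₂) mfel E₃ + (∑ p ∈ Q.primeFactors, ((p : ℝ) ^ (d + 1))⁻¹ + L47)) := by
    set A := flatGuessTest K N m₃ (rateGuessKernel n Q q' r B τ m₃) (uniformSamples (Fin n) (ZMod q') m₃) N' θ with hA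
    have hbound := blprs_theorem_4_1_bound_explicit (k := d) χh χN ζ (G * (N * m₃)) mfel R47 (fun s => noiseH₁ χN χh s) (discretizedGaussian Q α₂) hζ
      (η := 0) (L47 := L47) (fun z => by rw [PMF.tvDist_self]) h47 A'
    have hadv := advantage_rateGuess_hybridH₀' (r := r) (B := B) (τ := τ) (N := N) (N' := N') hn hε hε' hr hα₀ hN hN' hθ K
      (fun s => noiseH₁ χN χh s) ρ₀ ζ (fun z hz => ?_) hεθ hQθ
    · rw [mul_zero, zero_add] at hbound
      rw [← hA] at hadv
      have h₁ := hA' (hybridH₀ (fun s => noiseH₁ χN χh s) (G * (N * m₃)) ζ)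
      have h₂ := hA' (uniformSamples (Fin n) (ZMod Q) (G * (N * m₃)))
      rw [abs_le] at h₁ h₂
      have hle := le_abs_self ((acceptProb A' (hybridH₀ (fun s => noiseH₁ χN χh s) (G * (N * m₃)) ζ)).toReal -
        (acceptProb A' (uniformSamples (Fin n) (ZMod Q) (G * (N * m₃)))).toReal)
      rw [← hE₁, ← hE₂, ← hE₃] at hbound
      linarith [h₁.1, h₁.2, h₂.1, h₂.2]
    · obtain ⟨hB, hρ, w, hw⟩ := hζ' z hz
      exact ⟨hB, hρ, hnoise z hz, w, hw⟩
  -- the three padded / raised candidates and the best one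
  have hmM : (G * (N * m₃)) ≤ max (G * (N * m₃)) mfel := le_max_left _ _
  have hfM : mfel ≤ max (G * (N * m₃)) mfel := le_max_right _ _
  have hA₁ : distinguishingAdvantage (discretizedGaussian Q α₂) (max (G * (N * m₃)) mfel) (padThen hfM E₁) = distinguishingAdvantage (discretizedGaussian Q α₂) mfel E₁ :=
    distinguishingAdvantage_padThen _ hfM E₁
  have hA₃ : distinguishingAdvantage (discretizedGaussian Q α₂) (max (G * (N * m₃)) mfel) (padThen hfM E₃) = distinguishingAdvantage (discretizedGaussian Q α₂) mfel E₃ :=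
    distinguishingAdvantage_padThen _ hfM E₃
  have hA₂ : distinguishingAdvantage χh (G * (N * m₃)) E₂ - ((G * (N * m₃) : ℕ) : ℝ) * (1 / (2 * Q * α₂)) - 2 * ((max (G * (N * m₃)) mfel : ℕ) * νu) ≤
      distinguishingAdvantage (discretizedGaussian Q α₂) (max (G * (N * m₃)) mfel) (raiseThen χut (max (G * (N * m₃)) mfel) (padThen hmM E₂)) := by
    have hideal : distinguishingAdvantage χh (G * (N * m₃)) E₂ - ((G * (N * m₃) : ℕ) : ℝ) * (1 / (2 * Q * α₂)) ≤
        distinguishingAdvantage (discretizedGaussian Q α₂) (max (G * (N * m₃)) mfel) (raiseThen (discretizedGaussian Q u) (max (G * (N * m₃)) mfel) (padThen hmM E₂)) := by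
      have hC₂' : distinguishingAdvantage (discretizedGaussian Q α₂) (max (G * (N * m₃)) mfel) (raiseThen (discretizedGaussian Q u) (max (G * (N * m₃)) mfel) (padThen hmM E₂)) =
          distinguishingAdvantage (addConv (discretizedGaussian Q α₂) (discretizedGaussian Q u)) (G * (N * m₃)) E₂ := by
        rw [distinguishingAdvantage_raiseThen, distinguishingAdvantage_padThen]
      have habs := abs_distinguishingAdvantage_sub_le (ι := Fin d) (addConv (discretizedGaussian Q α₂) (discretizedGaussian Q u)) χh (G * (N * m₃)) E₂
      have htv := tvDist_addConv_discretizedGaussian_le Q hα₂ u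
      rw [abs_le] at habs
      rw [hC₂', hχh]
      rw [hχh] at habs
      nlinarith [habs.1, mul_le_mul_of_nonneg_left htv (Nat.cast_nonneg (G * (N * m₃)))]
    have hclose := distinguishingAdvantage_raiseThen_close (discretizedGaussian Q α₂) (m := max (G * (N * m₃)) mfel) hχut (padThen hmM E₂)
    linarith
  have hcases := exists_ge_of_weighted_sum_ge (x₁ := distinguishingAdvantage (discretizedGaussian Q α₂) mfel E₁)
    (x₂ := distinguishingAdvantage χh (G * (N * m₃)) E₂) (x₃ := distinguishingAdvantage (discretizedGaussian Q α₂) mfel E₃)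
    (ℓ := ∑ p ∈ Q.primeFactors, ((p : ℝ) ^ (d + 1))⁻¹ + L47) (Nat.cast_nonneg (G * (N * m₃))) hsum
  have hE : candVec χh χN ζ χut R47 A' = ![padThen hfM E₁, raiseThen χut (max (G * (N * m₃)) mfel) (padThen hmM E₂), padThen hfM E₃] := rfl
  have hraise0 : 0 ≤ ((G * (N * m₃) : ℕ) : ℝ) * (1 / (2 * Q * α₂)) := by
    have hQ : (0 : ℝ) < Q := by exact_mod_cast Nat.pos_of_ne_zero (NeZero.ne Q)
    positivity
  have hνu0 : 0 ≤ ((max (G * (N * m₃)) mfel : ℕ) : ℝ) * νu :=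
    mul_nonneg (Nat.cast_nonneg _) ((PMF.tvDist_nonneg _ _).trans hχut)
  have hbest : ∃ i, ηstar ≤ distinguishingAdvantage (discretizedGaussian Q α₂) (max (G * (N * m₃)) mfel) (candVec χh χN ζ χut R47 A' i) := by
    rw [hE]
    rcases hcases with h1 | h2 | h3
    · refine ⟨0, ?_⟩
      show ηstar ≤ distinguishingAdvantage (discretizedGaussian Q α₂) (max (G * (N * m₃)) mfel) (padThen hfM E₁)
      rw [hA₁]; linarith [hraise0, hνu0]
    · refine ⟨1, ?_⟩
      show ηstar ≤ distinguishingAdvantage (discretizedGaussian Q α₂) (max (G * (N * m₃)) mfel) (raiseThen χut (max (G * (N * m₃)) mfel) (padThen hmM E₂))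
      linarith
    · refine ⟨2, ?_⟩
      show ηstar ≤ distinguishingAdvantage (discretizedGaussian Q α₂) (max (G * (N * m₃)) mfel) (padThen hfM E₃)
      rw [hA₃]; linarith [hraise0, hνu0]
  exact distinguishingAdvantage_selectWith_ge (discretizedGaussian Q α₂) hNsel hηstar hbest Est hEst

end Selected

end BLPRS2013

end Literature.Computability.Cryptography

end
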